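import Summits.KontsevichZagierPeriods.KontsevichZagierPeriods.Theorems.TerasomaMultiplicationGammaHodgeSectorStubHodgeArithmetic
import Summits.KontsevichZagierPeriods.KontsevichZagierPeriods.Theorems.TerasomaMultiplicationGammaHodgeSectorStubSpanLift
import Summits.KontsevichZagierPeriods.KontsevichZagierPeriods.Theorems.TerasomaMultiplicationGammaHodgeSectorStubKernel
import Summits.KontsevichZagierPeriods.KontsevichZagierPeriods.Theorems.TerasomaMultiplicationGammaHodgeSectorStubProducts
import Summits.KontsevichZagierPeriods.KontsevichZagierPeriods.Theorems.TerasomaMultiplicationBetaCancellationEulerFinal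
import Literature.NumberTheory.Transcendental.KZKernelConjectureForms
import Literature.NumberTheory.Transcendental.KZLogCalculusProofs
import Summits.KontsevichZagierPeriods.KontsevichZagierPeriods.Theses.MotivatedMoves

/-!
# `GammaHodgeSector` (stmt-KontsevichZagierPeriods-3742) — the power identity and the
root-extraction reduction (glue of the line `koblitz-ogus-halving`)

Crux `Summit.KontsevichZagierPeriods.KontsevichZagierPeriods.Theses.TerasomaMultiplication.GammaHodgeSector`
(Deligne / Koblitz–Ogus Hodge-type Beta identities inside the Kontsevich–Zagier rules). This file
composes the five landed stubs of the line (`stub_hodgeArithmetic`, `stub_spanLift`, `stub_kernel`,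
`stub_betaRelators`, `stub_products`) with the realisation theorem `stub_realisation` of the
definitions file:

1. `lattice` — THE LATTICE THEOREM: for admissible Hodge-type data a positive multiple
   `n₀ · (Σⱼ [xⱼ,yⱼ] − Σₗ [x'ₗ,y'ₗ] − k·[½,½])` of the Beta symbol lies in the span `RelSpan` of the
   standard relators (Koblitz–Ogus `hodge_eq_combination_int`, PROVED in the tree, lifted from
   class functions on `ℤ/D` to the free symbol group `ℤ[ℚ × ℚ]`).
2. `gammaHodgeSector_pow` — THE POWER IDENTITY: under `MultiplicationAccessible` (crux 3),
   `EulerReflectionRational` (PROVED: `BetaCancellationLine.stub_eulerReflection`) and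
   `BetaCancellation` (crux 4), the two pinned representations of every instance of the crux
   satisfy `⟦r⟧^{n₀} = ⟦r'⟧^{n₀}` in `P = FormalRep ⧸ relations`, `n₀ ≥ 1` (Koblitz–Ogus INSIDE
   the rules).
3. `gammaHodgeSector_of_positiveRoots` — the crux from cruxes 3, 4 and ONE ring-theoretic
   principle, uniqueness of positive roots in `P` (the line's promoted stub, stated inline as a
   hypothesis; summit-implied: `gammaHodgeSector_of_kzKernelConjecture`).
4. `positiveRoots_of_positiveCancellation`, `betaCancellation_of_positiveCancellation`,
   `gammaHodgeSector_of_positiveCancellation` — what root extraction costs: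
   `⟦ρ⟧ⁿ − ⟦ρ'⟧ⁿ = S·(⟦ρ⟧ − ⟦ρ'⟧)` with `S = Σᵢ ⟦ρ⟧ⁱ⟦ρ'⟧ⁿ⁻¹⁻ⁱ` the class of an EFFECTIVE
   representation of positive value (`exists_rep_geom_sum`), so cancellation by effective
   classes of positive value (which contains `BetaCancellation`) gives positive roots and, with
   `MultiplicationAccessible` alone, the crux.

No new definitions; the open principles enter as explicit hypotheses. References: Deligne,
LNM 900 §7 (Thm 7.18, Koblitz–Ogus appendix); Das 2000; Kontsevich–Zagier 2001 §1.2, §4.1.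
-/

noncomputable section

open MeasureTheory Set
open scoped BigOperators
namespace Summit.KontsevichZagierPeriods.GammaHodgeSectorKO

open Literature.NumberTheory.Transcendental
open Literature.NumberTheory.Transcendental.KZ
open Literature.NumberTheory.Transcendental.BetaSymbol
open Literature.NumberTheory.Transcendental.KZreg (unitIoo)
open Summit.KontsevichZagierPeriods.GammaHodgeSectorNegative (Admissible HodgeCondition IsCubeBetaRep
  IsBallCubeRep gammaHodgeSector_iff commonDen commonDen_pos den_mul_den_dvd_commonDen den_mul_den_dvd_commonDen')
open Summit.KontsevichZagierPeriods.KontsevichZagierPeriods.BetaCancellationNegative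
  (KernelCancellation IsPinned betaKernel betaCancellation_iff isPinned_prod)
open Summit.KontsevichZagierPeriods.KontsevichZagierPeriods.Theses.TerasomaMultiplication
  (GammaHodgeSector MultiplicationAccessible BetaCancellation)
open Summit.KontsevichZagierPeriods.KontsevichZagierPeriods.Theses.CompiledSubstitutions (EulerReflectionRational)

/-! ## §1 The lattice theorem -/

/-- **THE LATTICE THEOREM of the line.** For admissible Hodge-type data, a positive multiple of
the symbol `Σ_j [x_j,y_j] − Σ_l [x'_l,y'_l] − k [½,½]` lies in the span of the standard relators:
Koblitz–Ogus (`nsmul_mem_koSpan_of_isKOHodge`) at the even level `D = 2·commonDen`, lifted to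
symbols by `stub_spanLift` and `stub_kernel`, the multiple of `[½,½]` being pinned by the weight.
[cite: Deligne1982HodgeCycles, Thm. 7.18, Rem. 7.16 (a)] -/
theorem lattice {N N' k : ℕ} (x y : Fin N → ℚ) (x' y' : Fin N' → ℚ)
    (hx : Admissible x y) (hx' : Admissible x' y') (hH : HodgeCondition N N' k x y x' y') :
    ∃ n₀ : ℕ, 0 < n₀ ∧
      n₀ • wordSym x y - n₀ • (wordSym x' y' + k • bsym (1 / 2) (1 / 2)) ∈ RelSpan := by
  classical
  set D : ℕ := 2 * commonDen x y x' y' with hDdef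
  have hD : 0 < D := Nat.mul_pos two_pos (commonDen_pos x y x' y')
  haveI : NeZero D := ⟨hD.ne'⟩
  have h2 : 2 ∣ D := dvd_mul_right 2 _
  have hcd : commonDen x y x' y' ∣ D := dvd_mul_left _ _
  have hlev : ∀ j, IsLevel D (x j) ∧ IsLevel D (y j) := fun j =>
    ⟨isLevel_of_den_dvd (hx j).1 (((dvd_mul_right _ _).trans
        (den_mul_den_dvd_commonDen x y x' y' j)).trans hcd),
     isLevel_of_den_dvd (hx j).2.1 (((dvd_mul_left _ _).trans
        (den_mul_den_dvd_commonDen x y x' y' j)).trans hcd)⟩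
  have hlev' : ∀ l, IsLevel D (x' l) ∧ IsLevel D (y' l) := fun l =>
    ⟨isLevel_of_den_dvd (hx' l).1 (((dvd_mul_right _ _).trans
        (den_mul_den_dvd_commonDen' x y x' y' l)).trans hcd),
     isLevel_of_den_dvd (hx' l).2.1 (((dvd_mul_left _ _).trans
        (den_mul_den_dvd_commonDen' x y x' y' l)).trans hcd)⟩
  obtain ⟨hKO, hwt, hwrel⟩ := stub_hodgeArithmetic x y x' y' hx hx' hH D hlev hlev'
  obtain ⟨n₀, hn₀, hspan⟩ := nsmul_mem_koSpan_of_isKOHodge D hKO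
  set w : BSym := wordSym x y - wordSym x' y' with hwdef
  have hwlev : w ∈ levelSym D :=
    sub_mem (sum_mem fun j _ => bsym_mem_levelSym (hlev j).1 (hlev j).2)
      (sum_mem fun l _ => bsym_mem_levelSym (hlev' l).1 (hlev' l).2)
  have hnw : clD D (n₀ • w) = (n₀ : ℤ) • clD D w := by
    rw [map_nsmul, natCast_zsmul]
  obtain ⟨s, hs, hcl, e, he⟩ := stub_spanLift D h2 ((n₀ : ℤ) • clD D w) hspan
    ⟨n₀ • w, AddSubgroup.nsmul_mem _ hwlev _, hnw⟩
  have hker : n₀ • w - s ∈ RelSpan :=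
    stub_kernel D (n₀ • w - s) (sub_mem (AddSubgroup.nsmul_mem _ hwlev _) hs)
      (by rw [map_sub, hcl, hnw, sub_self])
  have hmem : n₀ • w - e • bsym (1 / 2) (1 / 2) ∈ RelSpan := by
    have := add_mem hker he; rwa [sub_add_sub_cancel] at this
  -- pin the multiple of `[½,½]` by the weight
  have hw0 := hwrel _ hmem
  rw [map_sub, map_nsmul, map_zsmul, hwdef, map_sub, weight_betaHalf, smul_eq_mul, nsmul_eq_mul,
    hwt] at hw0
  have he' : e = (n₀ : ℤ) * k := by linarith
  subst he'
  refine ⟨n₀, hn₀, ?_⟩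
  have hrew : n₀ • wordSym x y - n₀ • (wordSym x' y' + k • bsym (1 / 2) (1 / 2)) =
      n₀ • w - ((n₀ : ℤ) * k) • bsym (1 / 2) (1 / 2) := by
    rw [hwdef, ← smul_smul, natCast_zsmul, natCast_zsmul, smul_sub, smul_add]
    abel
  rw [hrew]
  exact hmem

/-! ## §2 The power identity -/

/-- **All standard relator pairs hold in `P` up to positive constants** (symmetry, translation,
unit, Dirichlet re-association and reflection from `stub_betaRelators`; Gauss multiplication from
`stub_products` and `MultiplicationAccessible`). [cite: AndrewsAskeyRoy1999, Thm 1.8.1] -/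
theorem relatorsHold_of (hM : MultiplicationAccessible) (hR : EulerReflectionRational) :
    ∀ p ∈ relatorPairs, IsConstMultiple (prodClass p.1) (prodClass p.2) := by
  obtain ⟨hsym, htr, hunit, hdir, hrefl⟩ := stub_betaRelators
  obtain ⟨-, -, hmult⟩ := stub_products
  rintro ⟨L, R⟩ (((((h | h) | h) | h) | h) | h)
  · obtain ⟨a, b, ha, hb, hp⟩ := h
    simp only [Prod.mk.injEq] at hp
    obtain ⟨rfl, rfl⟩ := hp
    exact isConstMultiple_of_eq (by simpa using hsym a b ha hb)
  · obtain ⟨a, b, ha, hb, hp⟩ := h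
    simp only [Prod.mk.injEq] at hp
    obtain ⟨rfl, rfl⟩ := hp
    simpa using htr a b ha hb
  · obtain ⟨a, b, c, ha, hb, hc, hp⟩ := h
    simp only [Prod.mk.injEq] at hp
    obtain ⟨rfl, rfl⟩ := hp
    exact isConstMultiple_of_eq (by simpa using hdir a b c ha hb hc)
  · obtain ⟨n, s, hn, hs, hp⟩ := h
    simp only [Prod.mk.injEq] at hp
    obtain ⟨rfl, rfl⟩ := hp
    exact hmult hM n s hn hs
  · obtain ⟨a, ha, ha1, hp⟩ := h
    simp only [Prod.mk.injEq] at hp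
    obtain ⟨rfl, rfl⟩ := hp
    simpa using hrefl hR a ha ha1
  · simp only [Set.mem_singleton_iff, Prod.mk.injEq] at h
    obtain ⟨rfl, rfl⟩ := h
    exact isConstMultiple_of_eq (by simp [hunit])

/-- **THE POWER IDENTITY** (Koblitz–Ogus inside the rules): under `MultiplicationAccessible`,
`EulerReflectionRational` and `BetaCancellation`, the two representations of every instance of the
crux have EQUAL POSITIVE POWERS in the formal period ring: `⟦r⟧^{n₀} = ⟦r'⟧^{n₀}`, `n₀ ≥ 1`.
(Lattice theorem ⇒ symbol congruence; realisation over the non-zero-divisors `β(a,b)` ⇒ identity in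
`P` up to a positive algebraic constant; the product bookkeeping and `r.value = r'.value` pin the
constant to `c^{n₀}`.) [cite: Deligne1982HodgeCycles, Thm. 7.18] -/
theorem gammaHodgeSector_pow (hM : MultiplicationAccessible) (hR : EulerReflectionRational)
    (hB : BetaCancellation) {N N' k : ℕ} (x y : Fin N → ℚ) (x' y' : Fin N' → ℚ) (c : ℝ)
    (hx : Admissible x y) (hx' : Admissible x' y') (hH : HodgeCondition N N' k x y x' y')
    (hc : IsAlgebraic ℚ c) (r : IntegralRep N) (r' : IntegralRep (2 * k + N'))
    (hr : IsCubeBetaRep x y r) (hr' : IsBallCubeRep k x' y' c r') (hv : r.value = r'.value) :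
    ∃ n₀ : ℕ, 0 < n₀ ∧ 0 < r.value ∧ toFormalPeriod (of r) ^ n₀ = toFormalPeriod (of r') ^ n₀ := by
  classical
  obtain ⟨hcube, hball, -⟩ := stub_products
  have hrel := relatorsHold_of hM hR
  obtain ⟨n₀, hn₀, hmem⟩ := lattice x y x' y' hx hx' hH
  have hposx : ∀ j, 0 < x j ∧ 0 < y j := fun j => ⟨(hx j).1, (hx j).2.1⟩
  have hposx' : ∀ l, 0 < x' l ∧ 0 < y' l := fun l => ⟨(hx' l).1, (hx' l).2.1⟩
  -- the two words as multisets
  set m₁ : Multiset (ℚ × ℚ) := n₀ • wordMultiset x y with hm₁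
  set m₂ : Multiset (ℚ × ℚ) := n₀ • (wordMultiset x' y' + k • {((1 : ℚ) / 2, (1 : ℚ) / 2)}) with hm₂
  have hsym : msym m₁ - msym m₂ =
      n₀ • wordSym x y - n₀ • (wordSym x' y' + k • bsym (1 / 2) (1 / 2)) := by
    simp only [hm₁, hm₂, msym_nsmul, msym_add, msym_wordMultiset]
    simp [msym, bsym]
  obtain ⟨q, hq, hqpos, hEq⟩ := stub_realisation hB hrel m₁ m₂ (hsym ▸ hmem)
  set W : FormalPeriodRing := ∏ j, betaClass (x j) (y j) with hW
  set W' : FormalPeriodRing := ∏ l, betaClass (x' l) (y' l) with hW'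
  set B : FormalPeriodRing := betaClass (1 / 2) (1 / 2) with hB₀
  have hP1 : prodClass m₁ = W ^ n₀ := by
    rw [hm₁, prodClass_nsmul, prodClass_wordMultiset]
  have hP2 : prodClass m₂ = (W' * B ^ k) ^ n₀ := by
    rw [hm₂, prodClass_nsmul, prodClass_add, prodClass_wordMultiset, prodClass_nsmul,
      prodClass_singleton]
  rw [hP1, hP2] at hEq
  have hR1 : toFormalPeriod (of r) = W := hcube x y r hposx hr
  have hR2 : toFormalPeriod (of r') = kap c hc * B ^ k * W' := hball k x' y' c hc r' hposx' hr'
  -- values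
  have hvW : evalP W = r.value := by rw [← hR1, evalP_toFormalPeriod_of]
  have hWpos : 0 < evalP W := evalP_prod_betaClass_pos x y hposx
  have hW'pos : 0 < evalP (W' * B ^ k) := by
    rw [map_mul]; exact mul_pos (evalP_prod_betaClass_pos x' y' hposx') (evalP_betaHalf_pow_pos k)
  have hvr' : r'.value = c * evalP (W' * B ^ k) := by
    rw [← evalP_toFormalPeriod_of, hR2, map_mul, map_mul, evalP_kap, map_mul]; ring
  have hq_eq : q = c ^ n₀ := by
    have h1 := congrArg evalP hEq
    rw [map_pow, map_mul, evalP_kap, map_pow, hvW, hv, hvr', mul_pow] at h1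
    have hne : evalP (W' * B ^ k) ^ n₀ ≠ 0 := pow_ne_zero _ hW'pos.ne'
    have := mul_right_cancel₀ hne h1
    linarith [this]
  refine ⟨n₀, hn₀, hvW ▸ hWpos, ?_⟩
  rw [hR1, hR2, hEq, kap_congr hq (hc.pow n₀) hq_eq, kap_pow c hc n₀]
  ring

/-! ## §3 The crux from root extraction -/

/-- **`GammaHodgeSector` from the line's inputs**: Gauss multiplication as chains
(`MultiplicationAccessible`, stmt-12305), cancellation of Beta classes (`BetaCancellation`,
stmt-13633) — Euler reflection at rational arguments being PROVED in the tree
(`BetaCancellationLine.stub_eulerReflection`) — and ONE ring-theoretic principle taken as an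
explicit hypothesis: UNIQUENESS OF POSITIVE ROOTS in the formal period ring (two representations
with equal positive values and equal `n`-th powers in `P`, `n ≥ 1`, are equivalent; the promoted
stub `PositiveRoots` of this line; summit-implied via `positiveCancellation_of_kzKernelConjecture`).
[cite: Deligne1982HodgeCycles, Thm. 7.18] -/
theorem gammaHodgeSector_of_positiveRoots
    (hroot : ∀ (n : ℕ) ⦃d d' : ℕ⦄ (ρ : IntegralRep d) (ρ' : IntegralRep d'), 0 < n →
      toFormalPeriod (of ρ) ^ n = toFormalPeriod (of ρ') ^ n → 0 < ρ.value → ρ.value = ρ'.value →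
      Equivalent ρ ρ')
    (hM : MultiplicationAccessible) (hB : BetaCancellation) : GammaHodgeSector := by
  rw [gammaHodgeSector_iff]
  intro N N' k x y x' y' c hx hx' hH hc r r' hr hr' hv
  obtain ⟨n₀, hn₀, hpos, hpow⟩ := gammaHodgeSector_pow hM
    Summit.KontsevichZagierPeriods.KontsevichZagierPeriods.BetaCancellationLine.stub_eulerReflection
    hB x y x' y' c hx hx' hH hc r r' hr hr' hv
  exact hroot n₀ r r' hn₀ hpow hpos hv

/-- The same reduction for the verbatim copy of the crux in route `MotivatedMoves`
(stmt-KontsevichZagierPeriods-3742 is shared; the two route decls have the same body).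
[cite: Deligne1982HodgeCycles, Thm. 7.18] -/
theorem gammaHodgeSector_of_positiveRoots'
    (hroot : ∀ (n : ℕ) ⦃d d' : ℕ⦄ (ρ : IntegralRep d) (ρ' : IntegralRep d'), 0 < n →
      toFormalPeriod (of ρ) ^ n = toFormalPeriod (of ρ') ^ n → 0 < ρ.value → ρ.value = ρ'.value →
      Equivalent ρ ρ')
    (hM : MultiplicationAccessible) (hB : BetaCancellation) :
    Summit.KontsevichZagierPeriods.KontsevichZagierPeriods.Theses.MotivatedMoves.GammaHodgeSector :=
  gammaHodgeSector_of_positiveRoots hroot hM hB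

/-! ## §4 What root extraction costs: cancellation by effective classes of positive value -/

/-- Products of classes of effective representations of positive value are again such classes
(Fubini product of representations; multiplicativity of `evalP`). [cite: KontsevichZagier2001, §4.1] -/
theorem exists_rep_mul {z w : FormalPeriodRing}
    (hz : ∃ (d : ℕ) (σ : IntegralRep d), 0 < σ.value ∧ toFormalPeriod (of σ) = z)
    (hw : ∃ (d : ℕ) (σ : IntegralRep d), 0 < σ.value ∧ toFormalPeriod (of σ) = w) :
    ∃ (d : ℕ) (σ : IntegralRep d), 0 < σ.value ∧ toFormalPeriod (of σ) = z * w := by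
  obtain ⟨d, σ, hσ, rfl⟩ := hz
  obtain ⟨e, τ, hτ, rfl⟩ := hw
  refine ⟨d + e, σ.prod τ, ?_, (toFormalPeriod_of_mul_of σ τ).symm⟩
  have h := congrArg evalP (toFormalPeriod_of_mul_of σ τ)
  rw [map_mul, evalP_toFormalPeriod_of, evalP_toFormalPeriod_of, evalP_toFormalPeriod_of] at h
  rw [← h]
  exact mul_pos hσ hτ

/-- Sums of classes of effective representations of positive value are again such classes
(merging two representations into one: slabs at disjoint levels glued by domain additivity,
`IntegralRep.exists_of_add_of_sub_of_mem_relations`; additivity of `evalP`).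
[cite: KontsevichZagier2001, §1.2] -/
theorem exists_rep_add {z w : FormalPeriodRing}
    (hz : ∃ (d : ℕ) (σ : IntegralRep d), 0 < σ.value ∧ toFormalPeriod (of σ) = z)
    (hw : ∃ (d : ℕ) (σ : IntegralRep d), 0 < σ.value ∧ toFormalPeriod (of σ) = w) :
    ∃ (d : ℕ) (σ : IntegralRep d), 0 < σ.value ∧ toFormalPeriod (of σ) = z + w := by
  obtain ⟨d, σ, hσ, rfl⟩ := hz
  obtain ⟨e, τ, hτ, rfl⟩ := hw
  obtain ⟨m, R, hR⟩ := σ.exists_of_add_of_sub_of_mem_relations τ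
  have hP : toFormalPeriod (of σ) + toFormalPeriod (of τ) = toFormalPeriod (of R) := by
    rw [← map_add, toFormalPeriod_eq_iff]
    exact hR
  refine ⟨m, R, ?_, hP.symm⟩
  have h := congrArg evalP hP
  rw [map_add, evalP_toFormalPeriod_of, evalP_toFormalPeriod_of, evalP_toFormalPeriod_of] at h
  rw [← h]
  exact add_pos hσ hτ

/-- Powers of the class of an effective representation of positive value are classes of
effective representations of positive value (`⟦ρ⟧⁰ = ⟦[pt, 1]⟧`). [folklore] -/
theorem exists_rep_pow {d : ℕ} (ρ : IntegralRep d) (hρ : 0 < ρ.value) (i : ℕ) :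
    ∃ (e : ℕ) (σ : IntegralRep e), 0 < σ.value ∧ toFormalPeriod (of σ) = toFormalPeriod (of ρ) ^ i := by
  induction i with
  | zero =>
    exact ⟨0, IntegralRep.unit, by rw [IntegralRep.value_unit]; exact one_pos,
      by rw [pow_zero, toFormalPeriod_of_unit]⟩
  | succ i ih =>
    rw [pow_succ]
    exact exists_rep_mul ih ⟨d, ρ, hρ, rfl⟩

/-- **The geometric sum `S = Σ_{i<n} ⟦ρ⟧ⁱ ⟦ρ'⟧ⁿ⁻¹⁻ⁱ` is the class of an effective representation
of positive value** (`n ≥ 1`, `ρ`, `ρ'` of positive value). [folklore] -/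
theorem exists_rep_geom_sum {d d' : ℕ} (ρ : IntegralRep d) (ρ' : IntegralRep d')
    (hρ : 0 < ρ.value) (hρ' : 0 < ρ'.value) (n : ℕ) (hn : 0 < n) :
    ∃ (e : ℕ) (σ : IntegralRep e), 0 < σ.value ∧ toFormalPeriod (of σ) =
      ∑ i ∈ Finset.range n, toFormalPeriod (of ρ) ^ i * toFormalPeriod (of ρ') ^ (n - 1 - i) := by
  induction n with
  | zero => exact absurd hn (lt_irrefl 0)
  | succ n ih =>
    rcases Nat.eq_zero_or_pos n with rfl | hn'
    · simpa using exists_rep_pow ρ hρ 0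
    · -- `S_{n+1} = ⟦ρ'⟧ · S_n + ⟦ρ⟧ⁿ`
      obtain ⟨e, σ, hσ, hS⟩ := ih hn'
      have hsplit : ∑ i ∈ Finset.range (n + 1),
            toFormalPeriod (of ρ) ^ i * toFormalPeriod (of ρ') ^ (n + 1 - 1 - i) =
          toFormalPeriod (of ρ') *
              ∑ i ∈ Finset.range n, toFormalPeriod (of ρ) ^ i * toFormalPeriod (of ρ') ^ (n - 1 - i) +
            toFormalPeriod (of ρ) ^ n := by
        rw [Finset.sum_range_succ, Finset.mul_sum]
        congr 1
        · refine Finset.sum_congr rfl fun i hi => ?_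
          rw [Finset.mem_range] at hi
          have : n + 1 - 1 - i = (n - 1 - i) + 1 := by omega
          rw [this, pow_succ]
          ring
        · simp
      rw [hsplit]
      exact exists_rep_add (exists_rep_mul ⟨d', ρ', hρ', rfl⟩ ⟨e, σ, hσ, hS⟩) (exists_rep_pow ρ hρ n)

/-- **Cancellation by effective classes of positive value gives positive roots**: if
`⟦σ⟧ · z = 0 ⇒ z = 0` for every representation `σ` of positive value, then two representations
of positive (equal) value with `⟦ρ⟧ⁿ = ⟦ρ'⟧ⁿ` (`n ≥ 1`) are equivalent — because
`⟦ρ⟧ⁿ − ⟦ρ'⟧ⁿ = S · (⟦ρ⟧ − ⟦ρ'⟧)` with `S` effective of positive value (`exists_rep_geom_sum`).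
This is the exact form in which the line needs "root extraction by positivity". [folklore] -/
theorem positiveRoots_of_positiveCancellation
    (hC : ∀ ⦃d : ℕ⦄ (σ : IntegralRep d) (z : FormalPeriodRing), 0 < σ.value →
      toFormalPeriod (of σ) * z = 0 → z = 0) :
    ∀ (n : ℕ) ⦃d d' : ℕ⦄ (ρ : IntegralRep d) (ρ' : IntegralRep d'), 0 < n →
      toFormalPeriod (of ρ) ^ n = toFormalPeriod (of ρ') ^ n → 0 < ρ.value → ρ.value = ρ'.value →
      Equivalent ρ ρ' := by
  intro n d d' ρ ρ' hn hpow hρ hv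
  obtain ⟨e, σ, hσ, hS⟩ := exists_rep_geom_sum ρ ρ' hρ (hv ▸ hρ) n hn
  have key : toFormalPeriod (of σ) * (toFormalPeriod (of ρ) - toFormalPeriod (of ρ')) = 0 := by
    rw [hS, (Commute.all _ _).geom_sum₂_mul, hpow, sub_self]
  have h0 := hC σ _ hσ key
  rwa [← map_sub, toFormalPeriod_eq_zero_iff] at h0

/-- **Cancellation by effective classes of positive value contains `BetaCancellation`** (crux 4,
stmt-13633): a representation `q` pinned over `r` with the Beta kernel is congruent to
`β(a,b) × r`, so `q ∼ q'` reads `⟦β(a,b)⟧ · (⟦r⟧ − ⟦r'⟧) = 0` in `P`, and `value β(a,b) = B(a,b) > 0`.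
[folklore] -/
theorem betaCancellation_of_positiveCancellation
    (hC : ∀ ⦃d : ℕ⦄ (σ : IntegralRep d) (z : FormalPeriodRing), 0 < σ.value →
      toFormalPeriod (of σ) * z = 0 → z = 0) :
    BetaCancellation := by
  refine betaCancellation_iff.2 fun a b ha hb => ?_
  intro n m r r' q q' hq hq' hqq'
  set κ : IntegralRep 1 := betaRep a b ha hb with hκ
  have hpr := isPinned_prod (k := betaKernel a b) κ rfl (fun _ _ => rfl) r
  have hpr' := isPinned_prod (k := betaKernel a b) κ rfl (fun _ _ => rfl) r'
  have hc : of q - of (κ.prod r) ∈ relations :=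
    of_sub_of_mem_relations_of_eqOn (by rw [hpr.1, hq.1]) fun z hz => by
      rw [hq.2 hz, hpr.2 (by rw [hpr.1, ← hq.1]; exact hz)]
  have hc' : of q' - of (κ.prod r') ∈ relations :=
    of_sub_of_mem_relations_of_eqOn (by rw [hpr'.1, hq'.1]) fun z hz => by
      rw [hq'.2 hz, hpr'.2 (by rw [hpr'.1, ← hq'.1]; exact hz)]
  have h1 : of (κ.prod r) - of (κ.prod r') ∈ relations := by
    have := relations.sub_mem (relations.sub_mem hqq' hc) (relations.neg_mem hc')
    convert this using 1
    abel
  rw [← of_mul_of, ← of_mul_of, ← mul_sub, ← toFormalPeriod_eq_zero_iff, map_mul] at h1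
  have h2 := hC κ _ (betaRep_value_pos a b ha hb) h1
  rwa [toFormalPeriod_eq_zero_iff] at h2

/-- **`GammaHodgeSector` from `MultiplicationAccessible` and ONE cancellation principle**:
cancellation by effective classes of positive value in `P = FormalRep ⧸ relations` (explicit
hypothesis; it contains `BetaCancellation` and gives the root extraction the power identity needs).
[cite: Deligne1982HodgeCycles, Thm. 7.18] -/
theorem gammaHodgeSector_of_positiveCancellation
    (hC : ∀ ⦃d : ℕ⦄ (σ : IntegralRep d) (z : FormalPeriodRing), 0 < σ.value →
      toFormalPeriod (of σ) * z = 0 → z = 0)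
    (hM : MultiplicationAccessible) : GammaHodgeSector :=
  gammaHodgeSector_of_positiveRoots (positiveRoots_of_positiveCancellation hC) hM
    (betaCancellation_of_positiveCancellation hC)

/-- The cancellation principle itself is implied by the kernel form of Conjecture 1 (soundness:
`evalP (⟦σ⟧ z) = value σ · evalP z`), hence by the summit. [folklore] -/
theorem positiveCancellation_of_kzKernelConjecture (hK : KZKernelConjecture) :
    ∀ ⦃d : ℕ⦄ (σ : IntegralRep d) (z : FormalPeriodRing), 0 < σ.value →
      toFormalPeriod (of σ) * z = 0 → z = 0 := by
  intro d σ z hσ hz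
  obtain ⟨c, rfl⟩ := toFormalPeriod_surjective z
  have h := congrArg evalP hz
  rw [map_mul, evalP_toFormalPeriod_of, map_zero, mul_eq_zero] at h
  rcases h with h | h
  · exact absurd h hσ.ne'
  · rw [toFormalPeriod_eq_zero_iff]
    apply hK
    rwa [evalP_toFormalPeriod] at h

/-- **Sandwich**: the kernel form of Conjecture 1 gives the cancellation principle, hence positive
roots (`positiveRoots_of_positiveCancellation`) and, with `MultiplicationAccessible`, the crux — so
the hypotheses of the reductions above are never stronger than the summit. [folklore] -/
theorem gammaHodgeSector_of_kzKernelConjecture (hK : KZKernelConjecture)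
    (hM : MultiplicationAccessible) : GammaHodgeSector :=
  gammaHodgeSector_of_positiveCancellation (positiveCancellation_of_kzKernelConjecture hK) hM

end Summit.KontsevichZagierPeriods.GammaHodgeSectorKO
end
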